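import Mathlib.Algebra.BigOperators.Field
import Literature.MathematicalPhysics.QuantumFieldTheory.TorusChartSpinWaveLift
import HarnessLib

/-!
# Plaquette vorticity of angle configurations on charted tori

The vortex (large-gradient) side of the spin-wave / vortex decomposition of `XY`-type models on a charted
discrete torus (`TorusChart.lean`, `TorusChartSpinWaveLift.lean`).

* `TorusChart.d₂` — the coboundary in degree two,
  `d₂ ω (x; i, j, k) = (ω (x+e_i; j,k) - ω (x; j,k)) - (ω (x+e_j; i,k) - ω (x; i,k)) + (ω (x+e_k; i,j) - ω (x; i,j))`
  (the flux through the boundary of the `3`-cell, in the convention of `CubicalCochains.lean`), with the Bianchi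
  identity `d₂_d₁ : d₂ (d₁ θ) = 0`.
* `sum_d₁_eq_zero`: on a finite torus the total circulation of any `1`-cochain in a fixed plane orientation
  vanishes, `Σ_x d₁ θ (x; i, j) = 0` (translation invariance of `Σ_x`).
* `TorusChart.vort θ (x; i, j) ∈ ℤ` — the **plaquette vorticity** of an angle configuration `θ : Λ → Real.Angle`:
  the circulation of the reduced gradient field `redGrad θ` around the plaquette is `2π · vort`
  (`d₁_redGrad_eq_two_pi_mul_vort`); `|vort| ≤ 1` (`abs_vort_le_one`: each reduced gradient lies in `(-π, π]`);
  `vort = 0` at a plaquette whose four reduced gradients are `< π/2` in absolute value (`vort_eq_zero_of_abs_lt`);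
  the vorticity `2`-cochain is closed, `d₂ vort = 0` (`d₂_vort`: vortex lines have no ends), and neutral,
  `Σ_x vort θ (x; i, j) = 0` on a finite torus (`sum_vort_eq_zero`); an angle configuration is vortex-free iff its
  reduced gradient field is flat (`isFlat_redGrad_iff_vort_eq_zero`).
* **Peierls estimate for vortices** (appended): `one_le_one_sub_cos_of_pi_div_two_le_abs` (a gradient of size
  `≥ π/2` costs `1 − cos ≥ 1`), `abs_vort_le_sum_one_sub_cos` (a plaquette's `|vort|` is at most the `XY` energy
  `Σ (1 − cos redGrad)` of its four bonds), `sum_abs_vort_le` (**`Σ_{x,i,j} |vort θ (x;i,j)| ≤ 4d · Σ_{x,i} (1 − cos (redGrad θ (x;i)))`**: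
  on a finite torus the total vorticity is paid for by the gradient energy — the input of every Peierls /
  large-field bound `e^{−cK·#vortex plaquettes}`), and `one_sub_cos_redGrad_coe` (for a real representative
  `θ = ↑θ'` the bond energy is the usual `1 − cos (θ'(x+eᵢ) − θ'(x))`).
-/

namespace Literature.MathematicalPhysics.QuantumFieldTheory

open scoped BigOperators

namespace TorusChart

variable {Λ : Type*} [AddCommGroup Λ] {d : ℕ} (F : TorusChart Λ d)

section DegreeTwo

variable {A : Type*} [AddCommGroup A]

/-- The coboundary of a `2`-cochain: the flux through the boundary of the `3`-cell `(x; i, j, k)`,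
`∂ᵢ ω_{jk} - ∂ⱼ ω_{ik} + ∂_k ω_{ij}` with `∂ᵢ h (x) = h (x + e_i) - h x`. [folklore] -/
def d₂ (ω : Λ → Fin d → Fin d → A) : Λ → Fin d → Fin d → Fin d → A :=
  fun x i j k => (ω (x + F.gen i) j k - ω x j k) - (ω (x + F.gen j) i k - ω x i k) + (ω (x + F.gen k) i j - ω x i j)

/-- Unfolding `d₂`. [folklore] -/
@[simp] theorem d₂_apply (ω : Λ → Fin d → Fin d → A) (x : Λ) (i j k : Fin d) :
    F.d₂ ω x i j k =
      (ω (x + F.gen i) j k - ω x j k) - (ω (x + F.gen j) i k - ω x i k) + (ω (x + F.gen k) i j - ω x i j) := rfl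

/-- `d₂` is additive. [folklore] -/
theorem d₂_add (ω ω' : Λ → Fin d → Fin d → A) : F.d₂ (ω + ω') = F.d₂ ω + F.d₂ ω' := by
  funext x i j k; simp only [d₂_apply, Pi.add_apply]; abel

/-- `d₂ 0 = 0`. [folklore] -/
@[simp] theorem d₂_zero : F.d₂ (0 : Λ → Fin d → Fin d → A) = 0 := by
  funext x i j k; simp

/-- **Bianchi identity** `d₂ ∘ d₁ = 0`: the circulations of a `1`-cochain around the six faces of a `3`-cell
cancel (the unit translations commute). [folklore] -/
theorem d₂_d₁ (θ : Λ → Fin d → A) : F.d₂ (F.d₁ θ) = 0 := by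
  funext x i j k
  simp only [d₂_apply, d₁_apply, Pi.zero_apply, add_right_comm x (F.gen j) (F.gen i),
    add_right_comm x (F.gen k) (F.gen i), add_right_comm x (F.gen k) (F.gen j)]
  abel

/-- `d₂` commutes with a change of coefficients. [folklore] -/
theorem map_d₂ {B : Type*} [AddCommGroup B] (g : A →+ B) (ω : Λ → Fin d → Fin d → A) (x : Λ) (i j k : Fin d) :
    g (F.d₂ ω x i j k) = F.d₂ (fun y a b => g (ω y a b)) x i j k := by
  simp only [d₂_apply, map_sub, map_add]

/-- **Total circulation vanishes**: on a finite torus, `Σ_x d₁ θ (x; i, j) = 0` for every `1`-cochain and every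
plane orientation (the four sums are translates of each other). [folklore] -/
theorem sum_d₁_eq_zero [Fintype Λ] (θ : Λ → Fin d → A) (i j : Fin d) : ∑ x, F.d₁ θ x i j = 0 := by
  simp only [d₁_apply, Finset.sum_sub_distrib, Finset.sum_add_distrib]
  have hi : ∑ x, θ (x + F.gen i) j = ∑ x, θ x j :=
    Fintype.sum_equiv (Equiv.addRight (F.gen i)) _ _ fun x => rfl
  have hj : ∑ x, θ (x + F.gen j) i = ∑ x, θ x i :=
    Fintype.sum_equiv (Equiv.addRight (F.gen j)) _ _ fun x => rfl
  rw [hi, hj]; abel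

/-- The total of a gradient over a finite torus vanishes: `Σ_x d₀ f (x, i) = 0`. [folklore] -/
theorem sum_d₀_eq_zero [Fintype Λ] (f : Λ → A) (i : Fin d) : ∑ x, F.d₀ f x i = 0 := by
  simp only [d₀_apply, Finset.sum_sub_distrib]
  rw [Fintype.sum_equiv (Equiv.addRight (F.gen i)) (fun x => f (x + F.gen i)) f fun x => rfl, sub_self]

end DegreeTwo

/-! ## Plaquette vorticity -/

section Vorticity

open Real

/-- The circulation of the reduced gradient field of an angle configuration around any plaquette is an integer
multiple of `2π`. [folklore] -/
theorem exists_d₁_redGrad_eq (θ : Λ → Real.Angle) (x : Λ) (i j : Fin d) :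
    ∃ n : ℤ, F.d₁ (F.redGrad θ) x i j = n * (2 * π) := by
  have h : ((F.d₁ (F.redGrad θ) x i j : ℝ) : Real.Angle) = 0 := by
    have h1 := F.map_d₁ Real.Angle.coeHom (F.redGrad θ) x i j
    rw [Real.Angle.coe_coeHom] at h1
    have h2 : (fun y k => ((F.redGrad θ y k : ℝ) : Real.Angle)) = F.d₀ θ := by
      funext y k; exact F.coe_redGrad θ y k
    rw [h1, h2, d₁_d₀, Pi.zero_apply, Pi.zero_apply, Pi.zero_apply]
  obtain ⟨n, hn⟩ := Real.Angle.coe_eq_zero_iff.1 h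
  exact ⟨n, by rw [← hn, zsmul_eq_mul]⟩

/-- The **plaquette vorticity** of an angle configuration: the integer `vort θ (x; i, j)` with
`d₁ (redGrad θ) (x; i, j) = 2π · vort θ (x; i, j)`. [folklore] -/
noncomputable def vort (θ : Λ → Real.Angle) (x : Λ) (i j : Fin d) : ℤ :=
  round (F.d₁ (F.redGrad θ) x i j / (2 * π))

/-- **The circulation of the reduced gradients around a plaquette is `2π` times the vorticity.** [folklore] -/
theorem d₁_redGrad_eq_two_pi_mul_vort (θ : Λ → Real.Angle) (x : Λ) (i j : Fin d) :
    F.d₁ (F.redGrad θ) x i j = 2 * π * F.vort θ x i j := by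
  obtain ⟨n, hn⟩ := F.exists_d₁_redGrad_eq θ x i j
  have hπ : (2 * π) ≠ 0 := Real.two_pi_pos.ne'
  have hv : F.vort θ x i j = n := by
    rw [vort, hn, mul_div_cancel_right₀ _ hπ, round_intCast]
  rw [hv, hn, mul_comm]

/-- The vorticity as a real number. [folklore] -/
theorem vort_eq_div (θ : Λ → Real.Angle) (x : Λ) (i j : Fin d) :
    (F.vort θ x i j : ℝ) = F.d₁ (F.redGrad θ) x i j / (2 * π) := by
  rw [d₁_redGrad_eq_two_pi_mul_vort, mul_div_cancel_left₀ _ Real.two_pi_pos.ne']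

/-- **Plaquette vorticities are `0` or `±1`**: each of the four reduced gradients lies in `(-π, π]`, so the
circulation lies in `(-4π, 4π)`. [folklore] -/
theorem abs_vort_le_one (θ : Λ → Real.Angle) (x : Λ) (i j : Fin d) : |F.vort θ x i j| ≤ 1 := by
  have hπ : 0 < π := Real.pi_pos
  have hc := F.d₁_redGrad_eq_two_pi_mul_vort θ x i j
  rw [d₁_apply] at hc
  have b1 := Real.Angle.neg_pi_lt_toReal (F.d₀ θ x i)
  have b1' := Real.Angle.toReal_le_pi (F.d₀ θ x i)
  have b2 := Real.Angle.neg_pi_lt_toReal (F.d₀ θ (x + F.gen i) j)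
  have b2' := Real.Angle.toReal_le_pi (F.d₀ θ (x + F.gen i) j)
  have b3 := Real.Angle.neg_pi_lt_toReal (F.d₀ θ (x + F.gen j) i)
  have b3' := Real.Angle.toReal_le_pi (F.d₀ θ (x + F.gen j) i)
  have b4 := Real.Angle.neg_pi_lt_toReal (F.d₀ θ x j)
  have b4' := Real.Angle.toReal_le_pi (F.d₀ θ x j)
  simp only [redGrad] at hc
  have hlt : (2 * π) * (F.vort θ x i j : ℝ) < 4 * π := by rw [← hc]; linarith
  have hgt : -(4 * π) < (2 * π) * (F.vort θ x i j : ℝ) := by rw [← hc]; linarith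
  have h1 : (F.vort θ x i j : ℝ) < 2 := by nlinarith
  have h2 : (-2 : ℝ) < F.vort θ x i j := by nlinarith
  have h1' : F.vort θ x i j < 2 := by exact_mod_cast h1
  have h2' : -2 < F.vort θ x i j := by exact_mod_cast h2
  rw [abs_le]; constructor <;> omega

variable {F} in
/-- **No vortex through a plaquette with small gradients**: if the four reduced gradients around the plaquette
`(x; i, j)` are `< π/2` in absolute value, its vorticity vanishes. [folklore] -/
theorem vort_eq_zero_of_abs_lt {θ : Λ → Real.Angle} {x : Λ} {i j : Fin d}
    (h1 : |F.redGrad θ x i| < π / 2) (h2 : |F.redGrad θ (x + F.gen i) j| < π / 2)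
    (h3 : |F.redGrad θ (x + F.gen j) i| < π / 2) (h4 : |F.redGrad θ x j| < π / 2) : F.vort θ x i j = 0 := by
  have hc := F.d₁_redGrad_eq_two_pi_mul_vort θ x i j
  rw [d₁_apply] at hc
  rw [abs_lt] at h1 h2 h3 h4
  have hπ : 0 < π := Real.pi_pos
  have hlt : (2 * π) * (F.vort θ x i j : ℝ) < 2 * π := by rw [← hc]; linarith
  have hgt : -(2 * π) < (2 * π) * (F.vort θ x i j : ℝ) := by rw [← hc]; linarith
  have k1 : (F.vort θ x i j : ℝ) < 1 := by nlinarith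
  have k2 : (-1 : ℝ) < F.vort θ x i j := by nlinarith
  have k1' : F.vort θ x i j < 1 := by exact_mod_cast k1
  have k2' : -1 < F.vort θ x i j := by exact_mod_cast k2
  omega

variable {F} in
/-- **Vortex-free ⇔ flat reduced gradients**: the reduced gradient field of an angle configuration is flat iff
all plaquette vorticities vanish. [folklore] -/
theorem isFlat_redGrad_iff_vort_eq_zero (θ : Λ → Real.Angle) :
    F.IsFlat (F.redGrad θ) ↔ ∀ x i j, F.vort θ x i j = 0 := by
  constructor
  · intro h x i j
    have hc := F.d₁_redGrad_eq_two_pi_mul_vort θ x i j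
    rw [h x i j] at hc
    have : (F.vort θ x i j : ℝ) = 0 := by
      have hπ : (2 * π) ≠ 0 := Real.two_pi_pos.ne'
      exact (mul_eq_zero.1 hc.symm).resolve_left hπ
    exact_mod_cast this
  · intro h x i j
    rw [d₁_redGrad_eq_two_pi_mul_vort, h x i j, Int.cast_zero, mul_zero]

/-- The vorticity is alternating: the diagonal vanishes. [folklore] -/
theorem vort_self (θ : Λ → Real.Angle) (x : Λ) (i : Fin d) : F.vort θ x i i = 0 := by
  have h := F.vort_eq_div θ x i i
  rw [d₁_self, zero_div] at h
  exact_mod_cast h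

/-- The vorticity is alternating: antisymmetry. [folklore] -/
theorem vort_swap (θ : Λ → Real.Angle) (x : Λ) (i j : Fin d) : F.vort θ x j i = -F.vort θ x i j := by
  have h := F.vort_eq_div θ x j i
  rw [d₁_swap, neg_div, ← vort_eq_div] at h
  exact_mod_cast h

/-- **Vortex lines are closed** (`d₂ vort = 0`): the vorticity `2`-cochain of any angle configuration is closed,
being `(2π)⁻¹ d₁` of a real `1`-cochain. [folklore] -/
theorem d₂_vort (θ : Λ → Real.Angle) : F.d₂ (F.vort θ) = 0 := by
  funext x i j k
  have h : ((F.d₂ (F.vort θ) x i j k : ℤ) : ℝ) = 0 := by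
    have hm := F.map_d₂ (Int.castAddHom ℝ) (F.vort θ) x i j k
    simp only [Int.coe_castAddHom] at hm
    rw [hm]
    simp only [vort_eq_div]
    have hd : (fun y a b => F.d₁ (F.redGrad θ) y a b / (2 * π)) =
        fun y a b => (2 * π)⁻¹ * F.d₁ (F.redGrad θ) y a b := by
      funext y a b; rw [div_eq_inv_mul]
    rw [hd]
    have := F.map_d₂ ((2 * π)⁻¹ • (AddMonoidHom.id ℝ)) (F.d₁ (F.redGrad θ)) x i j k
    simp only [AddMonoidHom.smul_apply, AddMonoidHom.id_apply, smul_eq_mul] at this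
    rw [← this, d₂_d₁, Pi.zero_apply, Pi.zero_apply, Pi.zero_apply, Pi.zero_apply, mul_zero]
  exact_mod_cast h

/-- **Vortex neutrality**: on a finite torus the total vorticity in each plane orientation vanishes,
`Σ_x vort θ (x; i, j) = 0`. [folklore] -/
theorem sum_vort_eq_zero [Fintype Λ] (θ : Λ → Real.Angle) (i j : Fin d) : ∑ x, F.vort θ x i j = 0 := by
  have h : ((∑ x, F.vort θ x i j : ℤ) : ℝ) = 0 := by
    rw [Int.cast_sum]
    simp only [vort_eq_div]
    rw [← Finset.sum_div, F.sum_d₁_eq_zero, zero_div]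
  exact_mod_cast h

/-! ## Peierls estimate: vorticity is paid for by gradient energy -/

/-- A gradient of absolute value between `π/2` and `π` costs at least one unit of `XY` energy:
`1 ≤ 1 − cos t`. [folklore] -/
theorem one_le_one_sub_cos_of_pi_div_two_le_abs {t : ℝ} (h₁ : π / 2 ≤ |t|) (h₂ : |t| ≤ π) :
    1 ≤ 1 - Real.cos t := by
  have hc : Real.cos |t| ≤ 0 :=
    Real.cos_nonpos_of_pi_div_two_le_of_le h₁ (by linarith [Real.pi_pos])
  rw [Real.cos_abs] at hc
  linarith

/-- The `XY` bond energy is non-negative. [folklore] -/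
theorem one_sub_cos_nonneg (t : ℝ) : 0 ≤ 1 - Real.cos t := by linarith [Real.cos_le_one t]

variable {F} in
/-- **A plaquette's vorticity is at most the `XY` energy of its four bonds**:
`|vort θ (x;i,j)| ≤ Σ_{four bonds b of the plaquette} (1 − cos (redGrad θ b))` — if all four reduced gradients are
`< π/2` the vorticity vanishes (`vort_eq_zero_of_abs_lt`), otherwise one bond already pays `≥ 1 ≥ |vort|`.
[folklore] -/
theorem abs_vort_le_sum_one_sub_cos (θ : Λ → Real.Angle) (x : Λ) (i j : Fin d) :
    |(F.vort θ x i j : ℝ)| ≤ (1 - Real.cos (F.redGrad θ x i)) + (1 - Real.cos (F.redGrad θ (x + F.gen i) j)) +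
      (1 - Real.cos (F.redGrad θ (x + F.gen j) i)) + (1 - Real.cos (F.redGrad θ x j)) := by
  have hv1 : |(F.vort θ x i j : ℝ)| ≤ 1 := by exact_mod_cast F.abs_vort_le_one θ x i j
  have n1 := one_sub_cos_nonneg (F.redGrad θ x i)
  have n2 := one_sub_cos_nonneg (F.redGrad θ (x + F.gen i) j)
  have n3 := one_sub_cos_nonneg (F.redGrad θ (x + F.gen j) i)
  have n4 := one_sub_cos_nonneg (F.redGrad θ x j)
  by_cases h1 : |F.redGrad θ x i| < π / 2
  · by_cases h2 : |F.redGrad θ (x + F.gen i) j| < π / 2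
    · by_cases h3 : |F.redGrad θ (x + F.gen j) i| < π / 2
      · by_cases h4 : |F.redGrad θ x j| < π / 2
        · rw [vort_eq_zero_of_abs_lt h1 h2 h3 h4, Int.cast_zero, abs_zero]
          linarith
        · have := one_le_one_sub_cos_of_pi_div_two_le_abs (not_lt.1 h4) (F.abs_redGrad_le θ x j)
          linarith
      · have := one_le_one_sub_cos_of_pi_div_two_le_abs (not_lt.1 h3) (F.abs_redGrad_le θ _ i)
        linarith
    · have := one_le_one_sub_cos_of_pi_div_two_le_abs (not_lt.1 h2) (F.abs_redGrad_le θ _ j)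
      linarith
  · have := one_le_one_sub_cos_of_pi_div_two_le_abs (not_lt.1 h1) (F.abs_redGrad_le θ x i)
    linarith

variable {F} in
/-- **Peierls estimate on a finite torus**: the total (ordered-pair) plaquette vorticity is bounded by the gradient
energy, `Σ_x Σ_i Σ_j |vort θ (x;i,j)| ≤ 4d · Σ_x Σ_i (1 − cos (redGrad θ (x;i)))` (sum the four-bond bound over all
plaquettes; by translation invariance of `Σ_x` each of the four bond sums is `d` times the total energy). Since
`vort ∈ {0, ±1}` the left side counts the vortex plaquettes (each unordered plaquette twice), so a configuration with
`XY` energy `E` has at most `4dE` of them — the combinatorial input of the large-field / vortex Peierls bounds.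
[folklore] -/
theorem sum_abs_vort_le [Fintype Λ] (θ : Λ → Real.Angle) :
    ∑ x, ∑ i, ∑ j, |(F.vort θ x i j : ℝ)| ≤ 4 * d * ∑ x, ∑ i, (1 - Real.cos (F.redGrad θ x i)) := by
  set g : Λ → Fin d → ℝ := fun y k => 1 - Real.cos (F.redGrad θ y k) with hg
  set S : ℝ := ∑ x, ∑ i, g x i with hS
  -- the four bond sums
  have hsum₁ : ∑ x, ∑ i : Fin d, ∑ _j : Fin d, g x i = d * S := by
    simp only [Finset.sum_const, Finset.card_univ, Fintype.card_fin, nsmul_eq_mul, hS, Finset.mul_sum]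
  have hsum₄ : ∑ x, ∑ _i : Fin d, ∑ j : Fin d, g x j = d * S := by
    simp only [Finset.sum_const, Finset.card_univ, Fintype.card_fin, nsmul_eq_mul, hS, Finset.mul_sum]
  have hshift : ∀ k : Fin d, ∀ f : Λ → ℝ, ∑ x, f (x + F.gen k) = ∑ x, f x := fun k f =>
    Fintype.sum_equiv (Equiv.addRight (F.gen k)) _ _ fun _ => rfl
  have hsum₂ : ∑ x, ∑ i : Fin d, ∑ j : Fin d, g (x + F.gen i) j = d * S := by
    rw [Finset.sum_comm]
    have : ∀ i : Fin d, ∑ x, ∑ j : Fin d, g (x + F.gen i) j = S := fun i => by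
      rw [hS]; exact hshift i fun y => ∑ j, g y j
    simp only [this, Finset.sum_const, Finset.card_univ, Fintype.card_fin, nsmul_eq_mul]
  have hsum₃ : ∑ x, ∑ i : Fin d, ∑ j : Fin d, g (x + F.gen j) i = d * S := by
    rw [Finset.sum_comm]
    have hinner : ∀ i : Fin d, ∑ x, ∑ j : Fin d, g (x + F.gen j) i = ∑ _j : Fin d, ∑ x, g x i := fun i => by
      rw [Finset.sum_comm]
      exact Finset.sum_congr rfl fun j _ => hshift j fun y => g y i
    simp only [hinner, Finset.sum_const, Finset.card_univ, Fintype.card_fin, nsmul_eq_mul]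
    rw [hS, Finset.sum_comm, Finset.mul_sum]
  -- sum the pointwise bound
  calc ∑ x, ∑ i, ∑ j, |(F.vort θ x i j : ℝ)|
      ≤ ∑ x, ∑ i, ∑ j, (g x i + g (x + F.gen i) j + g (x + F.gen j) i + g x j) := by
        gcongr with x _ i _ j _
        exact abs_vort_le_sum_one_sub_cos θ x i j
    _ = ∑ x, ∑ i : Fin d, ∑ _j : Fin d, g x i + ∑ x, ∑ i : Fin d, ∑ j : Fin d, g (x + F.gen i) j +
          ∑ x, ∑ i : Fin d, ∑ j : Fin d, g (x + F.gen j) i + ∑ x, ∑ _i : Fin d, ∑ j : Fin d, g x j := by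
        simp only [Finset.sum_add_distrib]
    _ = 4 * d * S := by rw [hsum₁, hsum₂, hsum₃, hsum₄]; ring

variable {F} in
/-- For a real representative `θ = ↑θ'` of the angle configuration the bond energy of the reduced gradient is the
usual `XY` bond energy of `θ'`: `1 − cos (redGrad ↑θ' (x;i)) = 1 − cos (θ'(x + eᵢ) − θ'(x))` (so `sum_abs_vort_le`
bounds the vorticity by the `XY` energy written in the real angles of an integration variable). [folklore] -/
theorem one_sub_cos_redGrad_coe (θ' : Λ → ℝ) (x : Λ) (i : Fin d) :
    1 - Real.cos (F.redGrad (fun y => (θ' y : Real.Angle)) x i) = 1 - Real.cos (θ' (x + F.gen i) - θ' x) := by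
  rw [redGrad_apply, Real.Angle.cos_toReal, ← Real.Angle.coe_sub, Real.Angle.cos_coe]

variable {F} in
/-- Hence, for a real representative, **the total vorticity is bounded by the `XY` energy of `θ'`**:
`Σ_{x,i,j} |vort ↑θ' (x;i,j)| ≤ 4d · Σ_{x,i} (1 − cos (θ'(x+eᵢ) − θ'(x)))`. [folklore] -/
theorem sum_abs_vort_coe_le [Fintype Λ] (θ' : Λ → ℝ) :
    ∑ x, ∑ i, ∑ j, |(F.vort (fun y => (θ' y : Real.Angle)) x i j : ℝ)| ≤
      4 * d * ∑ x, ∑ i, (1 - Real.cos (θ' (x + F.gen i) - θ' x)) := by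
  have h := sum_abs_vort_le (F := F) (fun y => (θ' y : Real.Angle))
  simp only [one_sub_cos_redGrad_coe] at h
  exact h

end Vorticity

end TorusChart

end Literature.MathematicalPhysics.QuantumFieldTheory
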